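import Summits.AnomalousDissipation.AnomalousDissipation.Theses.DwellLadder

/-!
# Glue item `DwellLadder.StretchSustainmentGlue` (stmt-AnomalousDissipation-30106)

Sorry-free proof of the GLUE item of route `route-AnomalousDissipation-DwellLadder`: `HorizonExtension → WindowCompactnessLink → PowerRealisesDissipationLink → StretchSustainment` (three modus ponens: W turns ν-uniform loud stretches into long loud windows, K compacts them into a power-floor family, T realises dissipation).
Pure logic (composition of the pieces / modus ponens); no facts asserted.
Source: decomp-ad cell (lens-1 g8 HorizonJunction node splitGlue_holds / writer SketchHJ.lean); landed by the cell's prover seat.  Nothing here proves the summit.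
-/

set_option linter.dupNamespace false

namespace Summit.AnomalousDissipation.AnomalousDissipation.Theorems.CellGlue

open Summit.AnomalousDissipation.AnomalousDissipation.Theses
open Summit.AnomalousDissipation.AnomalousDissipation.Theses.DwellLadder

/-- GLUE item 30106 `StretchSustainmentGlue` by name (composition of the filed pieces). [folklore] -/
theorem stretchSustainmentGlue_holds : DwellLadder.StretchSustainmentGlue :=
  fun hW hK hT hLS => hT (hK (hW hLS))

end Summit.AnomalousDissipation.AnomalousDissipation.Theorems.CellGlue
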